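import Literature.MathematicalPhysics.QuantumFieldTheory.Balaban1983to89.B9SectBGStepAtLettersV2

/-!
# `Balaban1983to89.B9SectBStepFrameV2` — [B9] Sect. B (Theorem 3.4, pp. 400–407): THE WHOLE SECT.-B LETTERS DICTIONARY, FRAMES V2 —
# `SectBFrame₂` = the v2 frames of the ten KERNEL-FREE steps (G′: (3.42), (3.47), (3.43), (3.44), (3.45), analyticity; (3.48); G: (3.42),
# (3.47), analyticity) + the other fifteen member-steps DISPLAYED verbatim (five step fields), and ★★ `sectBStepPrinted_of_sectBFrame₂ :
# SectBFrame₂ … → ModelSignsOn → B9.Thm32Printed → B9.Thm33Printed → B9.SectBStepPrinted …` (row 13 of the N06 record from ONE binder)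

T. Bałaban, *Propagators for lattice gauge theories in a background field*, Commun. Math. Phys. **99** (1985) 389–434
[`Balaban1985BackgroundPropagators`, "B9"]; [4] = T. Bałaban, *Propagators and renormalization transformations for lattice
gauge theories. II*, Commun. Math. Phys. **96** (1984) 223–250 [`Balaban1984PropagatorsII`].

statement-level skeleton of published theorems with citation tags; proofs where landed; nothing here is a claim about the
Yang–Mills mass gap

THE PRINTED LOCUS (verbatim).  Theorem 3.4, p. 400: *"There exists a positive constant a₁ such that the operators G′(U),
(Q′(U)G′²(U)Q′*(U))⁻¹, R(U), G(U) extend to configurations U′U for α₁ ≦ a₁ as analytic functions of A. The extended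
operators satisfy all the inequalities of Theorems 3.1–3.3 correspondingly."*; p. 403 l. 1–9: *"applying Theorem 3.1 for
G′(U), the bound (3.63), the representation (3.64) and Lemma 2.1 of [4] we can prove all the statements (3.42)–(3.47) of
Theorem 3.1 for the operator G′(U′U), of course with different constants"*; p. 407: *"This way we get all these inequalities
for the operator G(U′U), the local ones follow from the bound (3.85) and Lemma 2.1 [4] … Thus Theorem 3.4 is proved, assuming
that Theorems 3.1–3.3 hold"*; Theorem 3.1 (3.46) p. 398: *"Finally, we have the inequalities in L²-norms ‖hG′(U)λ‖, ‖h∇_UG′(U)λ‖,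
‖hG′(U)∇*_Uλ‖, ‖h∇_U∇_UG′(U)λ‖, ‖h∇_UG′(U)∇*_Uλ‖, ‖hG′(U)∇*_U∇*_Uλ‖ ≦ B₀[(Lʲη)², Lʲη, Lʲη, 1, 1, 1]|h|e^{−δ₀d(y,y′)}‖λ‖ for
supp h ⊂ Δ(y), y ∈ Λ_j, supp λ ⊂ Δ(y′)"*.

THE POINT.  `B9SectBStepWhole.sectBStepPrinted_of_posBlockSteps` (this seat's gen 2) reduces the Sect.-B obligation `hB :
B9.SectBStepPrinted …` of the N06 record to FOURTEEN POSITIVE-INPUT BLOCK-STEPS (seven per family: (3.42), (3.46), (3.47), (3.43),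
(3.44), (3.45) and — once — (3.48) and analyticity) GIVEN Theorems 3.2 ∕ 3.3 at U.  The v1 capstone `B9SectBGStepAtLettersMore.SectBFrame`
(gen 3) framed ALL of them at r06's letters — but (i) every v1 frame inherited the unsatisfiable «∀ 0 < α < 1» Lemma-2.1 fields
(LOCATED-4), and (ii) twelve L² steps and the three G-side Hölder steps were framed over r06 theorems whose inputs are Theorems
3.1 ∕ 3.3 for the UNPERTURBED operator in the KERNEL form `|G′(U; x, x′)| ≦ B(Lʲη)²(L^{j′}η)^{−d}e^{−δd}` (`HasKernelBound`; the v1 laws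
`ker31` ∕ `kerG` ∕ `kerGp`), a shape the lit-balaban desk (pub-ymgap ME #13, 2026-08-26) records as NOT printed and NOT satisfied by
Bałaban's own propagators on multi-point blocks for d ≥ 3 (the diagonal of (Δ′_a)⁻¹ is ≳ η², above any block-uniform
`B(Lʲη)²(L^{j′}η)^{−d}` at coarse scales).  THIS FILE is the honest v2 capstone: `SectBFrame₂` extends the v2 frames of the TEN steps
whose r06 routes are kernel-free — `B9SectBGpStepAtLettersV2.GlobFrame₂` ∕ `H1Frame₂` ∕ `E4H2Frame₂` ∕ `AnFrame₂` (G′: (3.42) via the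
common `GpFrame₂`, (3.47), (3.43), (3.44)+(3.45), analyticity), `CinvFrame₂` ((3.48)), `B9SectBGStepAtLettersV2.GlobGFrame₂` ∕
`AnGFrame₂` (G: (3.42) via `GFrame₂`, (3.47), analyticity) — and DISPLAYS the other fifteen member-steps VERBATIM as five positive-input step
fields: the six (3.46) L² members per family (`stepL2Gp`, `stepL2G`) and the G-side (3.43) ∕ (3.44) ∕ (3.45) steps (`stepH1G`,
`stepE4G`, `stepH2G`).  ★★ `sectBStepPrinted_of_sectBFrame₂` then assembles row 13's `hB` from ONE binder `F : SectBFrame₂ …` + the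
model signs + Theorems 3.2 ∕ 3.3 of the leaf, exactly as v1 did.  What the displayed fields ASK is print's own Sect.-B statement
for those members («we can prove all the statements (3.42)–(3.47) … for the operator G′(U′U)»; «the local ones follow from the bound
(3.85) and Lemma 2.1»); an honest Lean route to them is an ℓ²-block (`B6RandomWalkL2.HasL2Majorant`) version of r06's Sect.-B
programme from the printed L² inputs (3.46) at U + (3.61) + (3.64) — not in the tree (successor item of this lineage).

HONEST SCOPE.  Hypothesis structure + one assembly theorem; nothing of [B9] asserted; `SectBFrame₂` is NOT shown inhabited here
(its inhabitant is the operator layer of record, NODE 00's `opsYOfRecord`, whose obligations are the fields — the ten framed steps'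
letters ∕ laws ∕ readings, the two M-thresholded Lemma-2.1 fields, and the five displayed step fields); count-neutral; NOT a node
discharge; nothing continuum ∕ OS ∕ mass-gap ∕ Clay.  Cell `pub-ymgap` (HUMAN RULING D-0062), Track A node N06 [B9], N06-ASSIGNMENT
row 13, seat `pub-ymgap-dag-n06-c` (g4), 2026-08-27.  v1 (`B9SectBGStepAtLettersMore.SectBFrame`, consumed by
`Summits/…/BalabanUVNodesN06SectBOfFrame` and the N06 certificate p487053) stays in the tree, correct but uninhabitable.
-/

noncomputable section

namespace Literature.MathematicalPhysics.QuantumFieldTheory.Balaban1983to89.B9SectBStepFrameV2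

open Literature.MathematicalPhysics.QuantumFieldTheory.Balaban1983to89
open Literature.MathematicalPhysics.QuantumFieldTheory.Balaban1983to89.B9SectBStepWhole (StepL2nPos StepH1Pos StepE4Pos StepH2Pos
  sectBStepPrinted_of_posBlockSteps stepL2Pos_of_members stepAnalyticPos_of_halves)
open Literature.MathematicalPhysics.QuantumFieldTheory.Balaban1983to89.B9SectBGpStepAtLettersV2 (GpFrame₂ CinvFrame₂ GlobFrame₂
  H1Frame₂ E4H2Frame₂ AnFrame₂ stepEPos_of_gpFrame₂ stepKerPos_of_cinvFrame₂ stepGlobPos_of_globFrame₂ stepH1Pos_of_h1Frame₂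
  stepE4Pos_of_e4h2Frame₂ stepH2Pos_of_e4h2Frame₂ stepAnalyticPos1_of_anFrame₂)
open Literature.MathematicalPhysics.QuantumFieldTheory.Balaban1983to89.B9SectBGStepAtLettersV2 (GFrame₂ GlobGFrame₂ AnGFrame₂
  stepEPos_of_gFrame₂ stepGlobPos_of_globGFrame₂ stepAnalyticPos1_of_anGFrame₂)

universe u

variable {I : Type} (c35 : ℝ) (geo : I → B9.Geometry) (bg : I → B9.Backgrounds)
  (Gp : ∀ i, B9.KernelFamily (geo i) (bg i))
  {𝔸 : Type u} [NormedRing 𝔸] [NormedAlgebra ℂ 𝔸] [CompleteSpace 𝔸] {ι : Type} [Fintype ι] [DecidableEq ι]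
  (b : Module.Basis ι ℝ 𝔸) (κ : Type) [Fintype κ] [LinearOrder κ]
  (S : I → Type) [∀ i, Fintype (S i)] [∀ i, DecidableEq (S i)]
  [∀ i, Fintype (geo i).Site] [∀ i, DecidableEq (geo i).Site] [∀ i, Nonempty (geo i).Site]

/-- **THE WHOLE SECT.-B LETTERS DICTIONARY, V2** — the v2 frames of the ten kernel-free steps on ONE set of letters (the shared
`GpFrame₂` ∕ `CinvFrame₂` ∕ `GFrame₂` fields are merged by structure inheritance): G′ side `GlobFrame₂`, `H1Frame₂`, `E4H2Frame₂`,
`AnFrame₂` (each ⊃ `GpFrame₂`), G side `GlobGFrame₂`, `AnGFrame₂` (each ⊃ `GFrame₂` ⊃ `CinvFrame₂`); PLUS the fifteen remaining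
positive-input block-steps of Sect. B DISPLAYED VERBATIM (print's statement for those members, p. 403 l. 1–9 and p. 407): the six
(3.46) L² members of G′(U′U) and of G(U′U) (`stepL2Gp`, `stepL2G`), and the (3.43), (3.44), (3.45) members of G(U′U) (`stepH1G`,
`stepE4G`, `stepH2G`) — the steps whose only routes in the tree consume the unprinted kernel form of Theorems 3.1 ∕ 3.3.  The
complete contract an operator-layer instance meets to discharge `hB : B9.SectBStepPrinted …` of the N06 record modulo Theorems
3.2 ∕ 3.3 (inputs of `sectBStepPrinted_of_sectBFrame₂`).  A hypothesis structure; nothing asserted.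
[cite: Balaban1985BackgroundPropagators, Thm 3.4 p.400 + Sect. B pp.400–407 + Thm 3.1 (3.43)–(3.46) p.398 + Thm 3.3 p.399] -/
structure SectBFrame₂ (GA : ∀ i, B9.KernelFamily (geo i) (bg i)) (Cinv : ∀ i, B9.SiteKernel (geo i) (bg i))
    (IsAnalyticExt : ∀ i, B9.KernelFamily (geo i) (bg i) → (bg i).Cfg → ℝ → Prop)
    extends GlobGFrame₂ c35 geo bg Gp b κ S GA Cinv, AnGFrame₂ c35 geo bg Gp b κ S GA Cinv IsAnalyticExt,
      GlobFrame₂ c35 geo bg Gp b κ S, H1Frame₂ c35 geo bg Gp b κ S, E4H2Frame₂ c35 geo bg Gp b κ S,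
      AnFrame₂ c35 geo bg Gp b κ S IsAnalyticExt where
  /-- DISPLAYED (3.46) for G′(U′U): the six positive-input L² block-steps, verbatim (p. 403 l. 1–9). -/
  stepL2Gp : ∀ n : Fin 6, StepL2nPos dB c35 geo bg Gp GA Cinv Gp n
  /-- DISPLAYED (3.46) for G(U′U): the six positive-input L² block-steps, verbatim (p. 407). -/
  stepL2G : ∀ n : Fin 6, StepL2nPos dB c35 geo bg Gp GA Cinv GA n
  /-- DISPLAYED (3.43) for G(U′U): the positive-input Hölder block-step, verbatim (p. 407). -/
  stepH1G : StepH1Pos dB c35 geo bg Gp GA Cinv GA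
  /-- DISPLAYED (3.44) for G(U′U): the positive-input input-Hölder block-step, verbatim (p. 407). -/
  stepE4G : StepE4Pos dB c35 geo bg Gp GA Cinv GA
  /-- DISPLAYED (3.45) for G(U′U): the positive-input input-Hölder block-step with Hölder output, verbatim (p. 407). -/
  stepH2G : StepH2Pos dB c35 geo bg Gp GA Cinv GA

variable {c35 geo bg Gp b κ S}

/-- ★★ **ROW 13's `hB` IN ONE INSTANTIATION (v2)**: every `SectBFrame₂`, together with the model signs of the readings and Theorems
3.2 ∕ 3.3 of the leaf (`B9.Thm32Printed` at the frame's dimension `dB`, `B9.Thm33Printed`), yields the Sect.-B obligation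
`B9.SectBStepPrinted F.dB c35 geo bg Gp GA Cinv IsAnalyticExt` of the N06 record — by `B9SectBStepWhole.sectBStepPrinted_of_posBlockSteps`
fed with its fourteen positive-input block-step arguments: nine (ten member-steps, the analytic step in two halves) inhabited at the letters by
the v2 frame theorems (over the R1-restated r06
theorems, with the M-thresholded ∕ rate-capped Lemma-2.1 fields of `GpFrame₂` — the bond-sector steps take the frame's own
`(F.d261, F.h261)` as their explicit Lemma-2.1 datum, v2.1), the other five (the twelve L² members via `stepL2Pos_of_members`, and the
G-side (3.43) ∕ (3.44) ∕ (3.45)) taken from the displayed fields.  Honest scope: the frame is NOT shown inhabited here; nothing of Sect. B is asserted beyond what r06's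
programme proves; the displayed steps are print's statement, not a proof.
[cite: Balaban1985BackgroundPropagators, Thm 3.4 p.400 + Sect. B pp.400–407 + Thms 3.1–3.3 pp.397–399] -/
theorem sectBStepPrinted_of_sectBFrame₂ {GA : ∀ i, B9.KernelFamily (geo i) (bg i)} {Cinv : ∀ i, B9.SiteKernel (geo i) (bg i)}
    {IsAnalyticExt : ∀ i, B9.KernelFamily (geo i) (bg i) → (bg i).Cfg → ℝ → Prop}
    (F : SectBFrame₂ c35 geo bg Gp b κ S GA Cinv IsAnalyticExt)
    {P : ∀ i, (geo i).Loc → Prop} (Sg : ∀ i, B9FromB6ModelSignsOn.ModelSignsOn (geo i) (P i))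
    (h32 : B9.Thm32Printed F.dB c35 geo bg Cinv) (h33 : B9.Thm33Printed c35 geo bg Gp GA) :
    B9.SectBStepPrinted F.dB c35 geo bg Gp GA Cinv IsAnalyticExt :=
  sectBStepPrinted_of_posBlockSteps Sg h32 h33
    (stepAnalyticPos_of_halves
      (stepAnalyticPos1_of_anFrame₂ F.toAnFrame₂ GA Cinv)
      (stepAnalyticPos1_of_anGFrame₂ F.toAnGFrame₂ F.d261 F.h261))
    (stepEPos_of_gpFrame₂ F.toGpFrame₂ GA Cinv)
    (stepL2Pos_of_members Sg F.stepL2Gp)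
    (stepGlobPos_of_globFrame₂ F.toGlobFrame₂ GA Cinv)
    (stepH1Pos_of_h1Frame₂ F.toH1Frame₂ GA Cinv)
    (stepE4Pos_of_e4h2Frame₂ F.toE4H2Frame₂ GA Cinv)
    (stepH2Pos_of_e4h2Frame₂ F.toE4H2Frame₂ GA Cinv)
    (stepKerPos_of_cinvFrame₂ F.toCinvFrame₂ GA)
    (stepEPos_of_gFrame₂ F.toGFrame₂ F.d261 F.h261)
    (stepL2Pos_of_members Sg F.stepL2G)
    (stepGlobPos_of_globGFrame₂ F.toGlobGFrame₂ F.d261 F.h261) F.stepH1G F.stepE4G F.stepH2G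

end Literature.MathematicalPhysics.QuantumFieldTheory.Balaban1983to89.B9SectBStepFrameV2
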